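import Literature.MathematicalPhysics.QuantumFieldTheory.Balaban1983to89.B8Eq191FlatStencilsRec
import Literature.MathematicalPhysics.QuantumFieldTheory.Balaban1983to89.B8Ineq159FlatMaps
import Literature.MathematicalPhysics.QuantumFieldTheory.Balaban1983to89.B7Prop4FlatCarriedLetterRec

/-!
# `Balaban1983to89.B8Ineq159FlatMapsRec` — [Balaban1985BackgroundPropagators] p. 394 «⊗ identity» FOR THE RECORD's AVERAGING STRUCTURE ([Balaban1987RG1] (0.3)–(0.4)):
# the flat transpose stencils `Q′(1)ᵀ`, the multiplier form of (1.38), print's straight iterate (127)∕(125) AND the record's linearised averaging `L^jηQ_j(1)` — carried gauge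
# letter included — all commute with continuous `ℂ`-linear maps; the record twin of `B8Ineq159FlatMaps` §2–§3 WITHOUT the engine's `linCovIter_one_left` (DO-NOT-REKEY, director-ym №269 (3))

statement-level skeleton of published theorems with citation tags; proofs where landed; nothing here is a claim about the Yang–Mills mass gap

CITATION HEADER (lean-in-tree rule).  Cell `pub-ymgap` (HUMAN RULING D-0062), «N05-REC» road (director-ym №254∕№255; LEAD PEN dag-n05-e g37); item R6 (δ sub-chain «flat letters at
`U₀ = 1`», `N05-REC-INVENTORY.md` §R6 row `B8Ineq159FlatMaps — A: isLandau138_map_flat, map_linCovIter_flat, map_QT_flat | B: map_linQIter, map_linQ`).  [4] =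
[Balaban1985BackgroundPropagators] (3.19)–(3.25) pp. 393–394 and p. 394 («we consider these operators ⊗ identity»); [6] = [Balaban1985RegularSpaces] (1.29) p. 81, (1.38) p. 82, (1.56)–(1.57)
p. 86; [3] = [Balaban1985Averaging] (125)–(127) pp. 36–37, (93) p. 31; [I] = [Balaban1987RG1] (0.3)–(0.4) pp. 252–253.  `--kind proof --supports stmt-QuantumFields-20541` (K0⁷; count-neutral;
no definition).

THE POINT OF THIS FILE (the LOCATED-N2 ∕ DO-NOT-REKEY surgery of the δ sub-chain, done once).  The engine proves `map_linCovIter_flat` («`φ` commutes with `Q_j(1)`») THROUGH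
`B9Eq316TowerFlatIsOneStep.linCovIter_one_left` («`Q_j(1)` IS the straight iterate»), which is FALSE for the record (`B7Prop4FlatCarriedLetterRec.linCovIterZ_one_eq`: `L^jηQ_j(1)B = Ŷ_j +
dΘ_j(B)`, `Θ_j ≠ 0`).  The STATEMENT survives: `Ŷ_j = linQIterZ`, the block mean `R̄(1)` and the curvature functional `Φ` are finite `ℝ`-linear combinations of bond values, so the carried
letter commutes with `φ` too, and `map_linCovIterZ_flat` holds — proved here from the identity of record, not from the false identification.

WHAT IS PROVED (sorry-free).  §1 ★`map_QTZ_one`, ★`isLandau138Z_map_one` (general codomain `𝔹`; the multiplier form of (1.38) for the record blocking is preserved by `φ`; the flat record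
stencils themselves are dag-n05-d's `B8Eq138LandauFlatOrthogonalRec.{qprimeT1Z_flat_apply, QprimeTZ_flat_apply, QTZ_flat_apply}`, the `𝔹 = ℂ` cases are dag-n07-w3's
`Node00.{map_QTZ_flat, isLandau138Z_map_flat}` — cited, not restated).  §2 `map_asum` (every word functional), `map_linQZ`, ★`map_linQIterZ` (print's straight iterate on centred blocks), `map_SZ`, `map_FhatZ`, `map_PhiZ` (the curvature functional),
`map_rlamZ_one` (the flat block mean), `map_carryIter_one` (the canonical flat carried letter), ★★★`map_linCovIterZ_flat` — **`φ (L^jηQ_j(1)B) = L^jηQ_j(1)(φ ∘ B)` FOR THE RECORD**.  §3 `norm_linQIterZ_le_global`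
(`‖Ŷ_j‖ ≤ Lʲ·sup‖B‖`), ★`norm_linCovIterZ_one_le` (`‖L^jηQ_j(1)B‖ ≤ (Lʲ + 8(d·s)²Σ_{i<j}L^{2i})·sup‖B‖` — the finite bound the (1.59) transfers' `wsup` members need).
HONEST SCOPE.  Flat abelian-linear bookkeeping; nothing of [3]∕[4]∕[6]∕[I] asserted; `HThm4Rec` UNDISCHARGED; N05 discharged of record untouched; N07 not claimable; counts unmoved (typed
28∕28 · discharged 8∕28); one finite 𝕋⁴ programme at fixed ε — nothing continuum ∕ ℝ⁴ ∕ OS ∕ mass gap ∕ Clay.  No `def`, no `instance`, no `notation`, no `sorry`.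
-/

set_option autoImplicit false

noncomputable section

open scoped BigOperators
open Finset

namespace Literature.MathematicalPhysics.QuantumFieldTheory.Balaban1983to89.B8Ineq159FlatMapsRec

open B7Prop1Explicit hiding Site
open B7Prop1Explicit renaming Site → SiteZ
open B7Eq78Linearization (conjR conjR_apply)
open BlockAveragingZd (offZ IdxZ avgIterZ avgIterZ_one)
open B8Ineq130Rec (fl)
open B7SectEFLinearisationRec (FhatZ linQZ linQIterZ linQIterZ_zero linQIterZ_succ linCovIterZ rlamZ bgTZ)
open B8Eq119TwistedAxialRec (bgTZ_one)
open B8Eq138LandauZd (covDivB covLap)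
open B8Eq138LandauZdRec (qprimeT1Z QprimeTZ QTZ IsLandau138Z)
open B8Eq138LandauFlatOrthogonalRec (QTZ_flat_apply)
open B8Eq191FlatStencils (conjR_unitOne conjR_unitOne_inv)
open B8Ineq159FlatMaps (map_covLap_indicator_covDivB_flat)
open B8Ineq130 (hol_one)
open B7Prop3FlatRecSide (SZ PhiZ)
open B7Prop3GaugeCarryRec (lamZ lamZ_one_left)
open B7Prop3PureGaugeRec (dcovF dcovF_apply rlamZ_eq)
open B7Prop4GaugeInductionRec (carryIter carryIter_zero carryIter_succ)
open B7Prop4FlatCarriedLetterRec (linCovIterZ_one_eq carryIter_one_succ)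
open T4Continuum (stairWord)

variable {d : ℕ}

/-! ## §1 `φ` commutes with the flat record transpose and preserves the multiplier form of (1.38) -/

section Landau

variable {𝔸 : Type*} [NormedRing 𝔸] [NormedAlgebra ℂ 𝔸] [CompleteSpace 𝔸]
variable {𝔹 : Type*} [NormedRing 𝔹] [NormedAlgebra ℂ 𝔹] [CompleteSpace 𝔹]

/-- ★ (RECORD TWIN of `B8Ineq159FlatMaps.map_QT_flat`; GENERAL codomain `𝔹` — dag-n07-w3's `Node00.map_QTZ_flat` in `Node00/TorusCoverLandau153RecBlocks` is the `𝔹 = ℂ` case, hence the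
distinct name.) `φ` commutes with the flat record transpose `Q′(1)ᵀ` on multipliers (odd `L`) — the right side of the multiplier form of (1.38).
[cite: Balaban1985RegularSpaces, (1.29) p.81, (1.38) p.82; Balaban1985BackgroundPropagators, (3.24) p.394, p.394 («⊗ identity»); Balaban1987RG1, (0.3) p.252] -/
theorem map_QTZ_one (φ : 𝔸 →L[ℂ] 𝔹) {L : ℕ} (hL : Odd L) (m : ℕ) (Λs : ℕ → Set (SiteZ d)) (μ : ℕ → SiteZ d → 𝔸) (x : SiteZ d) :
    φ (QTZ L m Λs (1 : SiteZ d → Fin d → 𝔸ˣ) μ x) = QTZ L m Λs (1 : SiteZ d → Fin d → 𝔹ˣ) (fun j z => φ (μ j z)) x := by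
  rw [QTZ_flat_apply hL, QTZ_flat_apply hL, map_sum]
  refine Finset.sum_congr rfl fun j _ => ?_
  rw [φ.map_smul_of_tower, B8Ineq159FlatMaps.map_indicator]

/-- ★ (RECORD TWIN of `B8Ineq159FlatMaps.isLandau138_map_flat`; general codomain `𝔹` — `Node00.isLandau138Z_map_flat` (dag-n07-w3) is the `𝔹 = ℂ` case.) **The flat Landau condition
(1.38), record blocking, is preserved by `φ`** (odd `L`): `R(1)D^{η*}_1A = 0` (multiplier form `IsLandau138Z`) for `A` gives it for `φ ∘ A`, with the multiplier `φ ∘ μ`.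
[cite: Balaban1985RegularSpaces, (1.38) p.82; Balaban1985BackgroundPropagators, (3.25) p.394, p.394 («⊗ identity»); Balaban1987RG1, (0.3) p.252] -/
theorem isLandau138Z_map_one (φ : 𝔸 →L[ℂ] 𝔹) {L m : ℕ} (hL : Odd L) {η : ℝ} {Ω₀ : Set (SiteZ d)} {Λs : ℕ → Set (SiteZ d)}
    {A : SiteZ d → Fin d → 𝔸} (h : IsLandau138Z L m η Ω₀ Λs (1 : SiteZ d → Fin d → 𝔸ˣ) A) :
    IsLandau138Z L m η Ω₀ Λs (1 : SiteZ d → Fin d → 𝔹ˣ) (fun z κ => φ (A z κ)) := by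
  obtain ⟨μ, hμ⟩ := h
  refine ⟨fun j z => φ (μ j z), fun x hx => ?_⟩
  rw [← map_covLap_indicator_covDivB_flat, ← map_QTZ_one φ hL, hμ x hx]

end Landau

/-! ## §2 `φ` commutes with every word functional, with print's straight iterate on centred blocks, and with the record's `L^jηQ_j(1)` -/

section Linear

variable {𝔸 : Type*} [NormedRing 𝔸] [NormedAlgebra ℂ 𝔸]
variable {𝔹 : Type*} [NormedRing 𝔹] [NormedAlgebra ℂ 𝔹]

/-- `φ(A(Γ)) = (φ ∘ A)(Γ)` for every word `Γ` (the abelian line functional is a signed sum of bond values). [cite: Balaban1985Averaging, p.24 (definition of A(Γ)); Balaban1985BackgroundPropagators, p.394 («⊗ identity»)] -/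
theorem map_asum (φ : 𝔸 →L[ℂ] 𝔹) (A : SiteZ d → Fin d → 𝔸) :
    ∀ (x : SiteZ d) (w : List (Letter d)), φ (asum A x w) = asum (fun z ν => φ (A z ν)) x w
  | x, [] => by simp
  | x, l :: w => by
    rw [asum_cons, asum_cons, map_add, map_asum φ A (x + l.vec) w]
    congr 1
    unfold stepA
    split_ifs <;> simp

/-- (RECORD TWIN of `B8Ineq159FlatMaps.map_linQ`.) `φ` commutes with print's one-step straight average (125) on CENTRED blocks `L·(Q₀A)_c = Σ_{x∈B(c₋)} L^{−d} A([x, x + Le_κ])`.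
[cite: Balaban1985Averaging, (125) p.36; Balaban1987RG1, (0.3) p.252] -/
theorem map_linQZ (φ : 𝔸 →L[ℂ] 𝔹) (L : ℕ) (A : SiteZ d → Fin d → 𝔸) (q : SiteZ d) (κ : Fin d) :
    φ (linQZ L A q κ) = linQZ L (fun z ν => φ (A z ν)) q κ := by
  unfold linQZ
  rw [map_sum]
  refine Finset.sum_congr rfl fun r _ => ?_
  rw [φ.map_smul_of_tower, map_asum]

/-- ★ (RECORD TWIN of `B8Ineq159FlatMaps.map_linQIter`.) `φ` commutes with print's straight iterate (127) on centred blocks, `Ŷ_j = linQIterZ L A j`.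
[cite: Balaban1985Averaging, (127) p.37, (125) p.36; Balaban1987RG1, (0.3) p.252] -/
theorem map_linQIterZ (φ : 𝔸 →L[ℂ] 𝔹) (L : ℕ) (A : SiteZ d → Fin d → 𝔸) :
    ∀ (j : ℕ) (z : SiteZ d) (κ : Fin d), φ (linQIterZ L A j z κ) = linQIterZ L (fun w ν => φ (A w ν)) j z κ
  | 0, z, κ => by simp
  | j + 1, z, κ => by
    rw [linQIterZ_succ, linQIterZ_succ, map_linQZ]
    congr 1
    funext w ν
    exact map_linQIterZ φ L A j w ν

/-- `φ` commutes with the σ-mean staircase functional `S(q)[A] = mean_{r,σ,σ′} A(Γ^σ_{q, q+o_r})` of the record's loop family. [cite: Balaban1987RG1, (0.3)–(0.4) pp.252–253; Balaban1985Averaging, (112) p.34] -/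
theorem map_SZ (φ : 𝔸 →L[ℂ] 𝔹) (L : ℕ) (A : SiteZ d → Fin d → 𝔸) (q : SiteZ d) :
    φ (SZ L A q) = SZ L (fun z ν => φ (A z ν)) q := by
  unfold SZ
  rw [map_sum]
  refine Finset.sum_congr rfl fun i _ => ?_
  rw [φ.map_smul_of_tower, map_asum]

/-- `φ` commutes with the tree-staircase frame functional `F̂(q)[A] = mean_r A(Γ_{q, q+o_r})` (112) at `V₀ = 1`. [cite: Balaban1985Averaging, (112) p.34, (110) p.34] -/
theorem map_FhatZ (φ : 𝔸 →L[ℂ] 𝔹) (L : ℕ) (A : SiteZ d → Fin d → 𝔸) (q : SiteZ d) :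
    φ (FhatZ L A q) = FhatZ L (fun z ν => φ (A z ν)) q := by
  unfold FhatZ
  rw [map_sum]
  refine Finset.sum_congr rfl fun r _ => ?_
  rw [φ.map_smul_of_tower, map_asum]

/-- `φ` commutes with the curvature functional `Φ = S − F̂` of LOCATED-N2 (the letter the record's linearised average carries). [cite: Balaban1987RG1, (0.4) p.253; Balaban1985Averaging, (112) p.34, (124) p.36] -/
theorem map_PhiZ (φ : 𝔸 →L[ℂ] 𝔹) (L : ℕ) (A : SiteZ d → Fin d → 𝔸) (q : SiteZ d) :
    φ (PhiZ L A q) = PhiZ L (fun z ν => φ (A z ν)) q := by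
  unfold PhiZ
  rw [map_sub, map_SZ, map_FhatZ]

/-- `φ` commutes with the flat block mean `(R̄θ)(y) = Σ_r L^{−d} θ(y + o_r)` (`rlamZ` at `V₀ = 1`: the transporters are `1`). [cite: Balaban1985Averaging, (78) p.30, (93) p.31] -/
theorem map_rlamZ_one (φ : 𝔸 →L[ℂ] 𝔹) (L : ℕ) (θ : SiteZ d → 𝔸) (y : SiteZ d) :
    φ (rlamZ L (1 : SiteZ d → Fin d → 𝔸ˣ) θ y) = rlamZ L (1 : SiteZ d → Fin d → 𝔹ˣ) (fun z => φ (θ z)) y := by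
  rw [rlamZ_eq, rlamZ_eq, map_sum]
  refine Finset.sum_congr rfl fun r _ => ?_
  rw [φ.map_smul_of_tower, hol_one, hol_one, conjR_unitOne, conjR_unitOne]

/-- `φ` commutes with the CANONICAL FLAT CARRIED LETTER `Θ_j(B)` of the lineage (`carryIter` with `R̄(1)` and `λ(1) = Φ` over `Ŷ = linQIterZ L B`): by the recursion
`Θ₀ = 0`, `Θ_{j+1}(z) = (R̄Θ_j)(Lz) + Φ_{Ŷ_j}(Lz)` (`B7Prop4FlatCarriedLetterRec.carryIter_one_succ`) and `map_rlamZ_one`, `map_PhiZ`, `map_linQIterZ`.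
[cite: Balaban1985Averaging, (93) p.31, (124) p.36, (127) p.37; Balaban1987RG1, (0.4) p.253] -/
theorem map_carryIter_one (φ : 𝔸 →L[ℂ] 𝔹) (L : ℕ) (B : SiteZ d → Fin d → 𝔸) :
    ∀ (j : ℕ) (z : SiteZ d),
      φ (carryIter (fun _ θ w => rlamZ L (1 : SiteZ d → Fin d → 𝔸ˣ) θ ((L : ℤ) • w))
          (fun _ A w => lamZ L (1 : SiteZ d → Fin d → 𝔸ˣ) A ((L : ℤ) • w)) (linQIterZ L B) j z)
        = carryIter (fun _ θ w => rlamZ L (1 : SiteZ d → Fin d → 𝔹ˣ) θ ((L : ℤ) • w))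
            (fun _ A w => lamZ L (1 : SiteZ d → Fin d → 𝔹ˣ) A ((L : ℤ) • w)) (linQIterZ L (fun w ν => φ (B w ν))) j z
  | 0, z => by simp [carryIter_zero]
  | j + 1, z => by
    rw [carryIter_one_succ, carryIter_one_succ, map_add, map_rlamZ_one, map_PhiZ]
    congr 1
    · congr 1
      funext w
      exact map_carryIter_one φ L B j w
    · congr 1
      funext w ν
      exact map_linQIterZ φ L B j w ν

variable [NormOneClass 𝔸] [NormOneClass 𝔹] [CompleteSpace 𝔸] [CompleteSpace 𝔹]

/-- ★★★ (RECORD TWIN of `B8Ineq159FlatMaps.map_linCovIter_flat`, NEW PROOF.) **`φ` COMMUTES WITH THE RECORD's LINEARISED AVERAGING `L^jηQ_j(1)` AT THE FLAT BACKGROUND**: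
`φ (linCovIterZ L 1 B j z κ) = linCovIterZ L 1 (φ ∘ B) j z κ` — from the identity of record `L^jηQ_j(1)B = Ŷ_j + dΘ_j(B)` (`B7Prop4FlatCarriedLetterRec.linCovIterZ_one_eq`): the
straight iterate AND the carried gauge letter commute with `φ`.  (The engine's route through `linCovIter_one_left` — «`Q_j(1)` is the straight iterate» — is not available for the
record: DO-NOT-REKEY, director-ym №269 (3); no bound on `B` is needed here.) [cite: Balaban1985Averaging, (127) p.37, (125) p.36, (93) p.31; Balaban1985BackgroundPropagators, p.394 («⊗ identity»); Balaban1987RG1, (0.4) p.253; Balaban1985RegularSpaces, (1.56)–(1.57) p.86] -/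
theorem map_linCovIterZ_flat (φ : 𝔸 →L[ℂ] 𝔹) {L s : ℕ} (hLs : L = 2 * s + 1) (B : SiteZ d → Fin d → 𝔸) (j : ℕ) (z : SiteZ d) (κ : Fin d) :
    φ (linCovIterZ L (1 : SiteZ d → Fin d → 𝔸ˣ) B j z κ) = linCovIterZ L (1 : SiteZ d → Fin d → 𝔹ˣ) (fun w ν => φ (B w ν)) j z κ := by
  rw [linCovIterZ_one_eq L hLs B j z κ, linCovIterZ_one_eq L hLs _ j z κ, map_add, map_linQIterZ, dcovF_apply, dcovF_apply, map_sub]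
  simp only [Pi.one_apply, conjR_unitOne, map_carryIter_one]

/-! ## §3 Sup-norm bounds at the flat background (the boundedness the (1.59) transfers need for their `wsup` members) -/

omit [NormOneClass 𝔸] [CompleteSpace 𝔸] in
/-- `‖Ŷ_j(B)‖ ≤ Lʲ·sup‖B‖` for print's straight iterate on centred blocks (each step: a probability mean of `L` bond values; the engine's `B7Prop4Flat.norm_linQIter_le`).
[cite: Balaban1985Averaging, (125)–(126) p.36, (127) p.37; Balaban1987RG1, (0.3) p.252] -/
theorem norm_linQIterZ_le_global {L : ℕ} (hL : 1 ≤ L) (B : SiteZ d → Fin d → 𝔸) {b : ℝ} (hb : 0 ≤ b) (hB : ∀ x κ, ‖B x κ‖ ≤ b) :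
    ∀ (j : ℕ) (z : SiteZ d) (κ : Fin d), ‖linQIterZ L B j z κ‖ ≤ (L : ℝ) ^ j * b
  | 0, z, κ => by simpa using hB z κ
  | j + 1, z, κ => by
    rw [linQIterZ_succ]
    have ih : ∀ x ν, ‖linQIterZ L B j x ν‖ ≤ (L : ℝ) ^ j * b := fun x ν => norm_linQIterZ_le_global hL B hb hB j x ν
    have h := B7Prop3FlatRecSide.norm_linQZ_le (linQIterZ L B j) ((L : ℤ) • z) (d * L + L) (by positivity) (fun x ν _ => ih x ν) L hL ((L : ℤ) • z) κ
      (by simp [l1])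
    calc ‖linQZ L (linQIterZ L B j) ((L : ℤ) • z) κ‖ ≤ (L : ℝ) * ((L : ℝ) ^ j * b) := h
      _ = (L : ℝ) ^ (j + 1) * b := by ring

/-- ★ **`‖L^jηQ_j(1)B‖ ≤ (Lʲ + 8(d·s)²·Σ_{i<j}L^{2i})·sup‖B‖` FOR THE RECORD** — the straight iterate plus the data shift `dΘ_j(B)` (every fine plaquette curl is `≤ 4·sup‖B‖`,
`B7Prop4FlatCarriedLetterRec.norm_dcovF_carried_flat_le`): the finite bound the `wsup` members of the flat (1.59) transfers need (the engine read it off `linCovIter_one_left`,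
which the record does not have). [cite: Balaban1985Averaging, (127)–(128) p.37, (93) p.31; Balaban1987RG1, (0.4) p.253; Balaban1985RegularSpaces, (1.59) p.86] -/
theorem norm_linCovIterZ_one_le {L s : ℕ} (hLs : L = 2 * s + 1) (B : SiteZ d → Fin d → 𝔸) {b : ℝ} (hb : 0 ≤ b) (hB : ∀ x κ, ‖B x κ‖ ≤ b)
    (j : ℕ) (z : SiteZ d) (κ : Fin d) :
    ‖linCovIterZ L (1 : SiteZ d → Fin d → 𝔸ˣ) B j z κ‖ ≤ ((L : ℝ) ^ j + 8 * ((d : ℝ) * s) ^ 2 * ∑ i ∈ range j, ((L : ℝ) ^ 2) ^ i) * b := by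
  have hL : 1 ≤ L := by omega
  have hM : ∀ (x : SiteZ d) (μ ν : Fin d), ‖asum B x (plaqWord μ ν)‖ ≤ 4 * b := fun x μ ν => by
    have h := B7Prop3StaircaseStokesCovRec.norm_asum_le'' hB (plaqWord μ ν) x
    simpa [plaqWord] using h
  have hΘ := B7Prop4FlatCarriedLetterRec.norm_dcovF_carried_flat_le L hLs B (by positivity : (0 : ℝ) ≤ 4 * b) _
    (B7Prop4FlatCarriedLetterRec.carryIter_one_zero L B) (fun j z => carryIter_one_succ L B j z) hM j z κ
  rw [linCovIterZ_one_eq L hLs B j z κ]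
  refine (norm_add_le _ _).trans ?_
  have h1 := norm_linQIterZ_le_global hL B hb hB j z κ
  calc ‖linQIterZ L B j z κ‖ + ‖dcovF (1 : SiteZ d → Fin d → 𝔸ˣ) _ z κ‖
      ≤ (L : ℝ) ^ j * b + 2 * (((d : ℝ) * s) ^ 2 * (4 * b) * ∑ i ∈ range j, ((L : ℝ) ^ 2) ^ i) := add_le_add h1 hΘ
    _ = ((L : ℝ) ^ j + 8 * ((d : ℝ) * s) ^ 2 * ∑ i ∈ range j, ((L : ℝ) ^ 2) ^ i) * b := by ring

end Linear

end Literature.MathematicalPhysics.QuantumFieldTheory.Balaban1983to89.B8Ineq159FlatMapsRec
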